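import Summits.QuantumFields.YangMills.Theorems.UV3LargeFieldEnvelopedResummation
import Summits.QuantumFields.YangMills.Theorems.UV3PinnedCollarBranch
import Summits.QuantumFields.YangMills.Theorems.UV3TowerOfACSmallFactorsAdm
import Summits.QuantumFields.YangMills.Theorems.UV3PinnedStepKnitOfPackage
import Summits.QuantumFields.Balaban3D.Proofs.LargeFieldStd
import Summits.QuantumFields.Balaban3D.Proofs.HistCount
import HarnessLib

/-!
# R3 (cell `ym3-torus`, YM₃ on T³ — a ladder RUNG, NOT d = 4, NOT the Clay problem) — R-19936-S∕U: **THE (41)_K HISTORY SUM OF THE T³ AC TOWER THROUGH ONE LARGE-FIELD CANDIDATE,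
# UNDER A TOP-LEVEL MASS ENVELOPE** (FILE 1 ✓`UV3LargeFieldEnvelopedResummation.largeField_enveloped_adm` (P) INSTANTIATED at the v1 package `AlphaInputsT3AC.PkgAt`)

Seat `ym-ust-19936-w6` g7 (R526 (S) hand; LOCATE `LOCATE-S-ORGAN-w6g7.md` 6114e073, 19936 evidence #60, rows T3∕T6).  THEOREMS ONLY (0 `def`, 0 `sorry`);
`--supports stmt-QuantumFields-19936 --as helper`; count-neutral; CONDITIONAL on the v1 (α) socket (`PkgAt`) and on a mass envelope at the field `W`.

CONTENTS (at `p : AlphaInputsT3AC.PkgAt F 𝔠 γ hγ hγ1 K`, `S = T3Scales F γ …`, `Kc = 𝔠.lane.carrier`; every identification `p.T.mainT`∕`Zterm`∕`LF`∕`sites`∕`g`∕`b₀`∕`p₀`,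
`(inputOfAC …).W.mass = massRecAC …` is `rfl`): §1 ★ `Zterm_top_le_booked` (`Zterm_K(r) ≤ Σ_{i<K} A·x(g_i)·zvol_i(P(r))` — booked `zcoefOf` (`LargeFieldStd.zcoefOf_le`) and the collar
count FILE 2 ✓`zvol_real_le_sum`), ★ `near_count_real_le` (the scale-`i` collar candidates of a level-`j` plaquette in real form `≤ C_coll·e^{3 log L (j−1−i)}·x(g_i)^{3r₀}`,
FILE 2 ✓`card_filter_near_le` + `LargeFieldStd.rcolOf_le`); §2 ★★★ `through_le_of_massEnvelope` — for every candidate `e ∈ allCodes K` and a field `W` at which every admissible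
non-trivial history has mass `≤ e^{A₁}`: `Σ_{r : e ∈ P(r)} m_K(r,W)·e^{−mainT_K(r,W) + Zterm_K(r)} ≤ e^{A₁}·e^{−(c₁∕8)p(g_{e.1})²}·e^{(3∕ℓ)(2L^m)³}`, `c₁ = 1∕(4N)`, `ℓ = ½ log L` — FILE 1 (P)
with masses `massRecAC` (vanish off admissible, `stdTowerInputAC_mass_eq_zero_of_not_admissible`), `disc` injective, candidates `HistCount.card_filter_allCodes_le_exp`, small factors
FILE 3a ✓`smallFactorsAdm_towerOfAC`, Z-terms §1, collar cover by definition, couplings on the window (`gk_pos`, `gk_le_one`, `xlog_gRun`), provisos ✓`Family.prov_hp∕prov_hb₁∕prov_hb₂`.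
The knit to the (S-ii) row of record is the sequel `UV3PinnedStepOrganOfMassEnvelope`.

HONEST SCOPE.  Bookkeeping over the socket's rows, the lane's geometry and FILEs 1, 2, 3a; the envelope is a HYPOTHESIS at the field `W`; nothing of hJ, `hSii`, `hlf`,
`stub_pinnedStep`, `HistoryTailL` (19936), the rung, d = 4, a mass gap or Clay is proved here.

References: T. Bałaban, Commun. Math. Phys. **102** (1985) 255–275 [Balaban1985UV3] ((38)–(41) p. 266, (67)–(71) p. 273, pp. 273–274, (7) p. 257, (5) p. 256).
-/

set_option autoImplicit false

noncomputable section

namespace Summit.QuantumFields.YangMills.Theorems.UV3PinnedStepThroughOfMassEnvelope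

open MeasureTheory
open scoped BigOperators
open Literature.MathematicalPhysics.QuantumFieldTheory.Balaban1983to89
open Literature.MathematicalPhysics.QuantumFieldTheory.Balaban1983to89.B10LargeField (xlog one_le_xlog pFun_eq xlog_gRun)
open Literature.MathematicalPhysics.QuantumFieldTheory.Balaban1983to89.T3ContinuumYM3Torus
open Literature.MathematicalPhysics.QuantumFieldTheory.Balaban1983to89.T3UnitLawDensityEML (ℰp)
open Literature.MathematicalPhysics.QuantumFieldTheory.Balaban1985CMP102
open Literature.MathematicalPhysics.QuantumFieldTheory.Balaban1985CMP102.Setting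
open Summit.QuantumFields.Balaban3D.Carriers
open Summit.QuantumFields.Balaban3D.Proofs.Primitives
open Summit.QuantumFields.Balaban3D.Proofs.ScalesArithmetic (gk_pos gk_le_one g0sq_pos gk_eq_gRun_norm)
open Summit.QuantumFields.Balaban3D.Proofs.Family (prov_hb₁ prov_hb₂ prov_hp)
open Summit.QuantumFields.Balaban3D.Proofs.TowerAC
open Summit.QuantumFields.Balaban3D.Proofs.StandardAC
open Summit.QuantumFields.Balaban3D.Proofs.InputsAC
open Summit.QuantumFields.Balaban3D.Proofs.MassesAC (massRecAC_nonneg)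
open Summit.QuantumFields.Balaban3D.Proofs.HistCount (card_filter_allCodes_le_exp)
open Summit.QuantumFields.Balaban3D.Proofs.LargeFieldStd (rcolOf_antitone rcolOf_le zcoefOf_le zcoefOf_nonneg)
open Summit.QuantumFields.YangMills.Theorems.UV3LargeFieldEnvelopedResummation (largeField_enveloped_adm)
open Summit.QuantumFields.YangMills.Theorems.UV3PinnedCollarBranch
open Summit.QuantumFields.YangMills.Theorems.UV3TowerOfACSmallFactorsAdm (smallFactorsAdm_towerOfAC)

variable {F : T3Family} {𝔠 : AlphaConsts F.L (suGroupModel 2).N} {γ : ℝ} {hγ : 0 < γ} {hγ1 : γ ≤ (min 𝔠.gamma0 1) ^ 2} {K : ℕ}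
  (p : AlphaInputsT3AC.PkgAt F 𝔠 γ hγ hγ1 K)

/-! ## §1 Numerics at the package: booked Z-terms against the counted collars; the collar candidates per scale in real form -/

/-- **`Zterm_K(r) ≤ Σ_{i<K} A·x(g_i)·zvol_i(P(r))`** at the unit lattice: the tower's booked Z-terms `Σ_{i<K} CZ_i·|Z_i(r)|` (`towerOfAC`, by `rfl`) with `CZ_i ≤ A·x(g_i)` (`LargeFieldStd.zcoefOf_le`,
`A = (Cz+Cv)+C₅+C₆+(|logσ₀|+dg)c₁`) and the collar count `|Z_i(r)| ≤ Σ_{(i′,p′)∈P(r), i′≤i} (K_c·x(g_{i′})^{r₀})³` (FILE 2 ✓`zvol_real_le_sum`, `K_c = 2(2(R₁+1)M₁ + 2B + 20)`).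
[cite: Balaban1985UV3, (39) p.266, (41) p.266] -/
theorem Zterm_top_le_booked (r : Hist (F.P K) K) :
    p.T.Zterm K r ≤ ∑ i ∈ Finset.range K,
      ((𝔠.lane.carrier.Cz + 𝔠.lane.carrier.Cv) + 𝔠.lane.carrier.C₅ + 𝔠.lane.carrier.C₆ +
          (|𝔠.lane.carrier.logσ₀| + 𝔠.lane.carrier.dg) * 𝔠.lane.carrier.c₁) *
        xlog ((T3Scales F γ hγ (hγ1.trans (sq_min_one_le _ 𝔠.gamma0_pos)) K).gk i) *
        ∑ e ∈ (Hist.disc r).filter (fun e => e.1 ≤ i),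
          (2 * (2 * ((𝔠.lane.carrier.R₁ + 1) * 𝔠.lane.carrier.M₁) + 2 * ((F.L : ℝ) * (3 * ((𝔠.lane.carrier.M₁ : ℝ) - 1)) + 3 * ((F.L : ℝ) - 1)) + 20) * 1) ^ 3 *
            xlog ((T3Scales F γ hγ (hγ1.trans (sq_min_one_le _ 𝔠.gamma0_pos)) K).gk e.1) ^ (3 * 𝔠.lane.carrier.r₀) := by
  set S := T3Scales F γ hγ (hγ1.trans (sq_min_one_le _ 𝔠.gamma0_pos)) K with hS
  have hSK : S.K = K := rfl
  have hL : 2 ≤ F.L := F.hL.2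
  have hR₁ : 0 ≤ 𝔠.lane.carrier.R₁ := 𝔠.R₁_nonneg
  have hr : 0 ≤ 𝔠.lane.carrier.r₀ := le_trans zero_le_one 𝔠.one_le_r₀
  have hM : 0 < 𝔠.lane.carrier.M₁ := 𝔠.lane.F.M₁_pos
  have hCz : 0 ≤ 𝔠.lane.carrier.Cz + 𝔠.lane.carrier.Cv := add_nonneg 𝔠.Cz_nonneg 𝔠.Cv_nonneg
  have h5 : 0 ≤ 𝔠.lane.carrier.C₅ := 𝔠.C₅_nonneg
  have h6 : 0 ≤ 𝔠.lane.carrier.C₆ := 𝔠.C₆_nonneg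
  have hc₁ : 0 ≤ 𝔠.lane.carrier.c₁ := by show (0 : ℝ) ≤ 3; norm_num
  have hg : ∀ i, i ≤ S.K → 0 < S.gk i ∧ S.gk i ≤ 1 := fun i hi => ⟨gk_pos S i, gk_le_one S S.gK_le_one i hi⟩
  have hZ : p.T.Zterm K r = ∑ i ∈ Finset.range K,
      zcoefOf S 𝔠.lane.carrier i * (ZVol 𝔠.lane.carrier.M₁ (rcolOf S 𝔠.lane.carrier) K r i : ℝ) := rfl
  rw [hZ]
  refine Finset.sum_le_sum fun i hi => ?_
  rw [Finset.mem_range] at hi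
  have hiK : i < S.K := by rw [hSK]; exact hi
  have hz := zcoefOf_le (S := S) 𝔠.lane.carrier hCz h5 h6 hc₁ i hiK
  have hz0 := zcoefOf_nonneg (S := S) 𝔠.lane.carrier hCz h5 h6 hc₁ i hiK
  have hcol := zvol_real_le_sum (S := S) 𝔠.lane.carrier.M₁ (rcolOf S 𝔠.lane.carrier) hM (rcolOf_antitone (S := S) 𝔠.lane.carrier hR₁ hr)
    hL (ρ' := (𝔠.lane.carrier.R₁ + 1) * 𝔠.lane.carrier.M₁) (by positivity) hr (rcolOf_le (S := S) 𝔠.lane.carrier hR₁ hr) hg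
    K le_rfl r i hi
  have hV0 : (0 : ℝ) ≤ (ZVol 𝔠.lane.carrier.M₁ (rcolOf S 𝔠.lane.carrier) K r i : ℝ) := Nat.cast_nonneg _
  calc zcoefOf S 𝔠.lane.carrier i * (ZVol 𝔠.lane.carrier.M₁ (rcolOf S 𝔠.lane.carrier) K r i : ℝ)
      ≤ (((𝔠.lane.carrier.Cz + 𝔠.lane.carrier.Cv) + 𝔠.lane.carrier.C₅ + 𝔠.lane.carrier.C₆ +
          (|𝔠.lane.carrier.logσ₀| + 𝔠.lane.carrier.dg) * 𝔠.lane.carrier.c₁) * xlog (S.gk i)) *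
          (ZVol 𝔠.lane.carrier.M₁ (rcolOf S 𝔠.lane.carrier) K r i : ℝ) := mul_le_mul_of_nonneg_right hz hV0
    _ ≤ _ := mul_le_mul_of_nonneg_left hcol (hz0.trans hz)


open Classical in
/-- **THE COLLAR CANDIDATES PER SCALE, REAL FORM**: for `i < j ≤ K`, the number of scale-`i` plaquettes near the level-`j` plaquette `a` (FILE 2 ✓`card_filter_near_le` at the chain radius
`ϱ_i = 2(Rcol i + B + 3) + 1` of ✓`exists_near_of_not_plaqCover_subset_Omega`) is at most `C_coll·e^{3 log L·(j−1−i)}·x(g_i)^{3r₀}`, `C_coll = 9(2D₁ + 6)³`,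
`D₁ = 2(R₁+1)M₁ + 2B + 15L + 7`, `B = 3L(M₁−1) + 3(L−1)` (`Rcol i ≤ (R₁+1)M₁·x(g_i)^{r₀}`, `LargeFieldStd.rcolOf_le`). [cite: Balaban1985UV3, (39) p.266, pp.273–274] -/
theorem near_count_real_le {L : ℕ} {S : Scales L} (Kc : CarrierConsts) (hL : 2 ≤ L) (hM : 0 < Kc.M₁) (hR₁ : 0 ≤ Kc.R₁) (hr : 0 ≤ Kc.r₀)
    {i j : ℕ} (hij : i < j) (hj : j ≤ S.K) (a : Plaq S.P j) :
    ((((Finset.univ : Finset (Plaq S.P i)).filter (fun q => ∃ c ∈ plaqCover q, ∃ x ∈ plaqCover a,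
        sdist (j - 1) c x ≤ 2 * (rcolOf S Kc i + (S.P.L * (S.P.d * (Kc.M₁ - 1)) + S.P.d * (S.P.L - 1)) + S.P.d) + 1)).card : ℕ) : ℝ)
      ≤ 9 * (2 * (2 * ((Kc.R₁ + 1) * Kc.M₁) + 2 * ((L : ℝ) * (3 * ((Kc.M₁ : ℝ) - 1)) + 3 * ((L : ℝ) - 1)) + 15 * L + 7) + 6) ^ 3 *
        Real.exp (3 * Real.log L * ((j - 1 - i : ℕ) : ℝ)) * xlog (S.gk i) ^ (3 * Kc.r₀) := by
  classical
  have hjP : j ≤ S.P.m + S.P.K := by show j ≤ S.m + S.K; omega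
  have hLP : 2 ≤ S.P.L := hL
  have hd : S.P.d = 3 := rfl
  have hPL : S.P.L = L := rfl
  have hM1 : 1 ≤ Kc.M₁ := hM
  have hL1 : 1 ≤ L := by omega
  have hLr : (2 : ℝ) ≤ L := by exact_mod_cast hL
  have hMr : (1 : ℝ) ≤ Kc.M₁ := by exact_mod_cast hM1
  -- the ℕ count of FILE 2
  have hN := card_filter_near_le (P := S.P) hLP hij hjP a
    (2 * (rcolOf S Kc i + (S.P.L * (S.P.d * (Kc.M₁ - 1)) + S.P.d * (S.P.L - 1)) + S.P.d) + 1)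
  rw [hd, hPL] at hN
  -- abbreviations in ℝ
  set x : ℝ := xlog (S.gk i) with hx
  set ρ' : ℝ := (Kc.R₁ + 1) * Kc.M₁ with hρ'
  set Br : ℝ := (L : ℝ) * (3 * ((Kc.M₁ : ℝ) - 1)) + 3 * ((L : ℝ) - 1) with hBr
  set D₁ : ℝ := 2 * ρ' + 2 * Br + 15 * L + 7 with hD₁
  set Ln : ℝ := (L : ℝ) ^ (j - 1 - i) with hLn
  have hx1 : 1 ≤ x := one_le_xlog (gk_pos S i) (gk_le_one S S.gK_le_one i (by omega))
  have hxr : 1 ≤ x ^ Kc.r₀ := Real.one_le_rpow hx1 hr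
  have hxr0 : 0 ≤ x ^ Kc.r₀ := by linarith
  have hρ0 : 0 ≤ ρ' := by rw [hρ']; positivity
  have hBr0 : 0 ≤ Br := by rw [hBr]; nlinarith
  have hD0 : 0 ≤ D₁ := by rw [hD₁]; positivity
  have hLn1 : 1 ≤ Ln := one_le_pow₀ (by linarith)
  have hRle : (rcolOf S Kc i : ℝ) ≤ ρ' * x ^ Kc.r₀ := rcolOf_le (S := S) Kc hR₁ hr i (by omega)
  -- the real reading of the chain radius plus the spread: `≤ D₁·x^{r₀}`
  have hϱ : ((2 * (rcolOf S Kc i + (L * (3 * (Kc.M₁ - 1)) + 3 * (L - 1)) + 3) + 1 : ℕ) : ℝ) + 15 * L ≤ D₁ * x ^ Kc.r₀ := by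
    push_cast [Nat.cast_sub hM1, Nat.cast_sub hL1]
    rw [hD₁, hBr]
    nlinarith [mul_nonneg hρ0 (sub_nonneg.mpr hxr), mul_nonneg hBr0 (sub_nonneg.mpr hxr),
      mul_nonneg (show (0:ℝ) ≤ 15 * L + 7 by positivity) (sub_nonneg.mpr hxr)]
  -- the ball parameter `2(R + 1) ≤ Ln·(2D₁ + 6)·x^{r₀}`
  have hball : ((2 * (L ^ (j - 1 - i) * ((2 * (rcolOf S Kc i + (L * (3 * (Kc.M₁ - 1)) + 3 * (L - 1)) + 3) + 1)
      + L * (2 * 3 + 6) + 3 * (L - 1) + 3) + 2 + 1) : ℕ) : ℝ) ≤ Ln * (2 * D₁ + 6) * x ^ Kc.r₀ := by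
    have hcast : ((2 * (L ^ (j - 1 - i) * ((2 * (rcolOf S Kc i + (L * (3 * (Kc.M₁ - 1)) + 3 * (L - 1)) + 3) + 1)
        + L * (2 * 3 + 6) + 3 * (L - 1) + 3) + 2 + 1) : ℕ) : ℝ)
        = 2 * (Ln * (((2 * (rcolOf S Kc i + (L * (3 * (Kc.M₁ - 1)) + 3 * (L - 1)) + 3) + 1 : ℕ) : ℝ) + 15 * L) + 3) := by
      push_cast [Nat.cast_sub hM1, Nat.cast_sub hL1]
      rw [hLn]
      ring
    rw [hcast]
    have h1 : Ln * (((2 * (rcolOf S Kc i + (L * (3 * (Kc.M₁ - 1)) + 3 * (L - 1)) + 3) + 1 : ℕ) : ℝ) + 15 * L) ≤ Ln * (D₁ * x ^ Kc.r₀) :=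
      mul_le_mul_of_nonneg_left hϱ (by linarith)
    nlinarith [mul_nonneg (by linarith : (0:ℝ) ≤ Ln - 1) (sub_nonneg.mpr hxr), mul_nonneg (by linarith : (0:ℝ) ≤ Ln) hD0,
      mul_nonneg (mul_nonneg (by linarith : (0:ℝ) ≤ Ln) hD0) hxr0]
  have hball0 : (0 : ℝ) ≤ ((2 * (L ^ (j - 1 - i) * ((2 * (rcolOf S Kc i + (L * (3 * (Kc.M₁ - 1)) + 3 * (L - 1)) + 3) + 1)
      + L * (2 * 3 + 6) + 3 * (L - 1) + 3) + 2 + 1) : ℕ) : ℝ) := Nat.cast_nonneg _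
  -- cube and count
  have hLn3 : Ln ^ 3 = Real.exp (3 * Real.log L * ((j - 1 - i : ℕ) : ℝ)) := by
    have hcast : 3 * Real.log L * ((j - 1 - i : ℕ) : ℝ) = (((j - 1 - i) * 3 : ℕ) : ℝ) * Real.log L := by push_cast; ring
    rw [hcast, Real.exp_nat_mul, Real.exp_log (by linarith : (0:ℝ) < L), hLn, ← pow_mul]
  have hx3 : (x ^ Kc.r₀) ^ 3 = x ^ (3 * Kc.r₀) := by
    rw [show (3 : ℝ) * Kc.r₀ = Kc.r₀ * ((3 : ℕ) : ℝ) by push_cast; ring, Real.rpow_mul_natCast (by linarith)]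
  calc ((((Finset.univ : Finset (Plaq S.P i)).filter (fun q => ∃ c ∈ plaqCover q, ∃ x ∈ plaqCover a,
        sdist (j - 1) c x ≤ 2 * (rcolOf S Kc i + (L * (3 * (Kc.M₁ - 1)) + 3 * (L - 1)) + 3) + 1)).card : ℕ) : ℝ)
      ≤ ((3 * 3 * (2 * (L ^ (j - 1 - i) * ((2 * (rcolOf S Kc i + (L * (3 * (Kc.M₁ - 1)) + 3 * (L - 1)) + 3) + 1)
          + L * (2 * 3 + 6) + 3 * (L - 1) + 3) + 2 + 1)) ^ 3 : ℕ) : ℝ) := by exact_mod_cast hN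
    _ = 9 * ((2 * (L ^ (j - 1 - i) * ((2 * (rcolOf S Kc i + (L * (3 * (Kc.M₁ - 1)) + 3 * (L - 1)) + 3) + 1)
          + L * (2 * 3 + 6) + 3 * (L - 1) + 3) + 2 + 1) : ℕ) : ℝ) ^ 3 := by push_cast; ring
    _ ≤ 9 * (Ln * (2 * D₁ + 6) * x ^ Kc.r₀) ^ 3 := by
        refine mul_le_mul_of_nonneg_left (pow_le_pow_left₀ hball0 hball 3) (by norm_num)
    _ = 9 * (2 * D₁ + 6) ^ 3 * Real.exp (3 * Real.log L * ((j - 1 - i : ℕ) : ℝ)) * x ^ (3 * Kc.r₀) := by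
        rw [mul_pow, mul_pow, hLn3, hx3]; ring

/-! ## §2 The sum over the histories THROUGH one candidate, under the envelope (FILE 1 (P) at the package) -/

/-- ★★★ **THE HISTORIES THROUGH ONE CANDIDATE, UNDER THE MASS ENVELOPE.**  At the package's data `p` (run `K`), for a unit-lattice field `W` at which every admissible non-trivial history
has mass `≤ e^{A₁}`, and every candidate `e ∈ allCodes K` (a scale-tagged plaquette code, scale `< K`):
`Σ_{r : e ∈ P(r)} m_K(r,W)·exp(−mainT_K(r,W) + Zterm_K(r)) ≤ e^{A₁}·exp(−(c₁∕8)·p(g_{e.1})²)·exp((3∕ℓ)·(2L^m)³)`, `c₁ = 1∕(4N)`, `ℓ = ½ log L` — FILE 1 ✓`largeField_enveloped_adm` (P) with: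
masses `massRecAC` (vanish off admissible: `stdTowerInputAC_mass_eq_zero_of_not_admissible`; envelope: the hypothesis, histories through `e` are non-trivial), `disc` injective
(`Hist.disc_injective`), candidates counted by `HistCount.card_filter_allCodes_le_exp`, small factors FILE 3a ✓`smallFactorsAdm_towerOfAC`, Z-terms §1 `Zterm_top_le_booked`, collar cover by
definition, couplings `T3Scales` on the window (`gk_pos`, `gk_le_one`, `xlog_gRun`), provisos ✓`Family.prov_hp∕prov_hb₁∕prov_hb₂`. [cite: Balaban1985UV3, (41) p.266, (67)–(71) p.273, pp.273–274] -/
theorem through_le_of_massEnvelope {A₁ : ℝ} (W : GaugeField (F.P K) K (Matrix.specialUnitaryGroup (Fin 2) ℂ))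
    (hW : ∀ r : Hist (F.P K) K,
      Hist.Admissible 𝔠.lane.carrier.M₁ (rcolOf (T3Scales F γ hγ (hγ1.trans (sq_min_one_le _ 𝔠.gamma0_pos)) K) 𝔠.lane.carrier) K r →
      r ≠ Hist.triv (F.P K) K → (inputOfAC 𝔠.lane p.X p.𝔖).W.mass K r W ≤ Real.exp A₁)
    (e : ℕ × PlaqCode (F.P K)) (he : e ∈ allCodes (F.P K) K) :
    ∑ r ∈ (Finset.univ : Finset (Hist (F.P K) K)).filter (fun r => e ∈ Hist.disc r),
        (inputOfAC 𝔠.lane p.X p.𝔖).W.mass K r W * Real.exp (-(p.T.mainT K r W) + p.T.Zterm K r)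
      ≤ Real.exp A₁ *
          Real.exp (-(1 / (4 * ((suGroupModel 2).N : ℝ)) / 8 *
            B10.pFun 𝔠.lane.carrier.b₀ 𝔠.lane.carrier.p₀ ((T3Scales F γ hγ (hγ1.trans (sq_min_one_le _ 𝔠.gamma0_pos)) K).gk e.1) ^ 2)) *
        Real.exp (3 / (Real.log F.L / 2) * (2 * (F.L : ℝ) ^ F.m) ^ 3) := by
  classical
  set S := T3Scales F γ hγ (hγ1.trans (sq_min_one_le _ 𝔠.gamma0_pos)) K with hS
  have hSK : S.K = K := rfl
  have hL : 2 ≤ F.L := F.hL.2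
  have hLr : (2 : ℝ) ≤ F.L := by exact_mod_cast hL
  have hR₁ : 0 ≤ 𝔠.lane.carrier.R₁ := 𝔠.R₁_nonneg
  have hr : 0 ≤ 𝔠.lane.carrier.r₀ := le_trans zero_le_one 𝔠.one_le_r₀
  have hM : 0 < 𝔠.lane.carrier.M₁ := 𝔠.lane.F.M₁_pos
  have hCz : 0 ≤ 𝔠.lane.carrier.Cz + 𝔠.lane.carrier.Cv := add_nonneg 𝔠.Cz_nonneg 𝔠.Cv_nonneg
  have h5 : 0 ≤ 𝔠.lane.carrier.C₅ := 𝔠.C₅_nonneg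
  have h6 : 0 ≤ 𝔠.lane.carrier.C₆ := 𝔠.C₆_nonneg
  have hc₁ : 0 ≤ 𝔠.lane.carrier.c₁ := by show (0 : ℝ) ≤ 3; norm_num
  have hNpos : 0 < (suGroupModel 2).N := (suGroupModel 2).N_pos
  have hg : ∀ i, i ≤ K → 0 < S.gk i ∧ S.gk i ≤ 1 := fun i hi => ⟨gk_pos S i, gk_le_one S S.gK_le_one i hi⟩
  have hlogL : 0 < Real.log F.L := Real.log_pos (by linarith)
  have hℓ : 0 < Real.log (F.L : ℝ) / 2 := by positivity
  -- the site count at the unit lattice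
  have hsites : (Fintype.card (Site (F.P K) K) : ℝ) = (2 * (F.L : ℝ) ^ F.m) ^ 3 := by
    rw [Site.card_site]
    have : (F.P K).sitesPerDir K = 2 * F.L ^ F.m := by simp [Params.sitesPerDir]
    rw [this]
    push_cast
    rfl
  -- the progression of the couplings
  have hx : ∀ i, i ≤ K → xlog (S.gk i) = xlog (S.gk K) + ((K - i : ℕ) : ℝ) * (Real.log F.L / 2) := by
    intro i hi
    rw [gk_eq_gRun_norm S i, gk_eq_gRun_norm S K]
    exact xlog_gRun 1 (F.L : ℝ) S.g0sq one_pos (by linarith) (g0sq_pos S) hi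
  -- the sign of `A` and the provisos
  have hA : 0 ≤ (𝔠.lane.carrier.Cz + 𝔠.lane.carrier.Cv) + 𝔠.lane.carrier.C₅ + 𝔠.lane.carrier.C₆ +
      (|𝔠.lane.carrier.logσ₀| + 𝔠.lane.carrier.dg) * 𝔠.lane.carrier.c₁ := by
    have := 𝔠.lane.carrier.dg_nonneg
    have := abs_nonneg 𝔠.lane.carrier.logσ₀
    positivity
  have hp := prov_hp 𝔠
  have hb₁ := prov_hb₁ 𝔠 hNpos
  have hb₂ := prov_hb₂ 𝔠 hNpos
  have hcL : 𝔠.lane.consts.L = (F.L : ℝ) := rfl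
  rw [hcL] at hb₁
  have hMr : (1 : ℝ) ≤ 𝔠.lane.carrier.M₁ := by exact_mod_cast hM
  have hcg : (0 : ℝ) ≤ (2 * (2 * ((𝔠.lane.carrier.R₁ + 1) * 𝔠.lane.carrier.M₁) +
      2 * ((F.L : ℝ) * (3 * ((𝔠.lane.carrier.M₁ : ℝ) - 1)) + 3 * ((F.L : ℝ) - 1)) + 20)) * 1 := by
    have h1 : (0 : ℝ) ≤ (𝔠.lane.carrier.R₁ + 1) * 𝔠.lane.carrier.M₁ := by positivity
    have h2 : (0 : ℝ) ≤ (F.L : ℝ) * (3 * ((𝔠.lane.carrier.M₁ : ℝ) - 1)) := by nlinarith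
    nlinarith
  refine (largeField_enveloped_adm (k := K) (K := K) le_rfl S.gk (b₀ := 𝔠.lane.carrier.b₀) (p₀ := 𝔠.lane.carrier.p₀)
    (A := (𝔠.lane.carrier.Cz + 𝔠.lane.carrier.Cv) + 𝔠.lane.carrier.C₅ + 𝔠.lane.carrier.C₆ +
      (|𝔠.lane.carrier.logσ₀| + 𝔠.lane.carrier.dg) * 𝔠.lane.carrier.c₁) (A₀ := 0)
    (c₁ := 1 / (4 * ((suGroupModel 2).N : ℝ))) (gs := 1)
    (cg := 2 * (2 * ((𝔠.lane.carrier.R₁ + 1) * 𝔠.lane.carrier.M₁) + 2 * ((F.L : ℝ) * (3 * ((𝔠.lane.carrier.M₁ : ℝ) - 1)) + 3 * ((F.L : ℝ) - 1)) + 20))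
    (ρ := 1) (r₀ := 𝔠.lane.carrier.r₀) (ℓ := Real.log F.L / 2) (xK := xlog (S.gk K)) (S := (2 * (F.L : ℝ) ^ F.m) ^ 3)
    (σ := 3 * Real.log F.L) (Menv := Real.exp A₁)
    (allCodes (F.P K) K) (fun e he => Hist.disc_lt _ e he) ?cardE
    ((Finset.univ : Finset (Hist (F.P K) K)).filter (fun r => e ∈ Hist.disc r))
    (Hist.Admissible 𝔠.lane.carrier.M₁ (rcolOf S 𝔠.lane.carrier) K) Hist.disc
    (fun r _ _ => Hist.disc_subset_allCodes r) ((Hist.disc_injective K).injOn.mono (Set.subset_univ _))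
    (fun r => (inputOfAC 𝔠.lane p.X p.𝔖).W.mass K r W) (fun r => p.T.mainT K r W) (fun r => p.T.Zterm K r)
    (fun i Q => ∑ e ∈ Q.filter (fun e => e.1 ≤ i),
      (2 * (2 * ((𝔠.lane.carrier.R₁ + 1) * 𝔠.lane.carrier.M₁) + 2 * ((F.L : ℝ) * (3 * ((𝔠.lane.carrier.M₁ : ℝ) - 1)) + 3 * ((F.L : ℝ) - 1)) + 20) * 1) ^ 3 *
        xlog (S.gk e.1) ^ (3 * 𝔠.lane.carrier.r₀))
    (Real.exp_pos _).le ?madm ?menv ?sf ?zt (fun Q _ i _ => le_rfl)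
    hA le_rfl (by positivity) hcg hr hℓ (by positivity) hg le_rfl hx hp ?b1 ?b2).2 e he ?pin
  case cardE =>
    intro i hi
    have h := card_filter_allCodes_le_exp (P := F.P K) rfl hi (by show K ≤ F.m + K; omega)
    rw [hsites] at h
    exact h
  case madm =>
    intro r _ hna
    exact stdTowerInputAC_mass_eq_zero_of_not_admissible p.X 𝔠.lane.carrier p.𝔖 K r W hna
  case menv =>
    intro r hr' hadm
    rw [zero_mul, Real.exp_zero, mul_one]
    have hmem : e ∈ Hist.disc r := (Finset.mem_filter.mp hr').2
    have hne : r ≠ Hist.triv (F.P K) K := by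
      rintro rfl
      rw [Hist.disc_triv] at hmem
      exact Finset.notMem_empty e hmem
    exact hW r hadm hne
  case sf =>
    intro r _ hadm
    exact smallFactorsAdm_towerOfAC (T3Scales_window F 𝔠 γ hγ hγ1 K) hL p.run K le_rfl W r hadm
  case zt =>
    intro r _ _
    exact Zterm_top_le_booked p r
  case b1 =>
    simpa using hb₁
  case b2 =>
    nlinarith [hb₂, hlogL]
  case pin =>
    intro r hr' _
    exact (Finset.mem_filter.mp hr').2


end Summit.QuantumFields.YangMills.Theorems.UV3PinnedStepThroughOfMassEnvelope

end
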